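import Mathlib
import Literature.Computability.Complexity.FixedDimILPVertices
import Literature.Computability.Complexity.FixedDimILPRoundingMap
import HarnessLib

/-!
# Lenstra's algorithm in fixed dimension, IX: the simplex search is correct

Topic `Computability/Complexity`, grouping namespace `FixedDimILP`. Correctness of step 3 of the list
program (`FixedDimILPPrograms.lean`): for a tuple `cand` of `N + 1` listed vertices `pᵢ/dᵢ`, the integer
data `numer` (numerators `Pᵢ` over the common denominator `D = Π dᵢ`), `edgeRows` (`W̃`), `gRows`
(`invMatrix W̃`), `delta2` (`det(W̃)²`), `baryNum` ARE the objects of files II and VI, and the exact test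
`baryTest` decides "all barycentric coordinates of `v` lie in `[-1, 1]`"; so `goodTuple` decides the
property of file II, and by the maximal-volume theorem of file II a good tuple EXISTS whenever the polytope
contains a box — then `goodTuples` is non-empty and its head is good.

* `numVec`, `Pof`, `ptsOf`; `denomProd_pos`, `pts_Pof` (`Pᵢ/D = pᵢ/dᵢ`), `edgeRows_eq`, `detZ_edgeRows`,
  `gRows_eq`, `delta2_eq`, `baryNum_eq`;
* **`baryTest_iff`**, **`goodTuple_iff`**;
* **`exists_goodTuple`** and `head_goodTuples` (the chosen tuple is good).

## References

* H. W. Lenstra, Jr., Math. Oper. Res. 8 (1983), §2 (the simplex of maximal volume; remark (b)). [LenstraHW1983]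
* A. Schrijver, *Theory of Linear and Integer Programming*, 1986, Thm. 18.7 (rounding). [Schrijver1986]
* H. Cohen, GTM 138, §2.6.3 (`invMatrix`). [Cohen1993]
-/

noncomputable section

namespace Literature.Computability.Complexity

namespace FixedDimILP

open Matrix Finset Literature.Algebra.EuclideanLattices Literature.Algebra.EuclideanLattices.GSInverse IntDetFP

variable {N : ℕ}

/-! ### The integer data of a candidate tuple -/

/-- The integer numerator vector of a list vertex. [folklore] -/
def numVec (N : ℕ) (v : LVert) : Fin N → ℤ := fun j => v.1.getD j 0

/-- The real point of a vertex is `numVec / d`. [folklore] -/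
theorem ptOf_apply (v : LVert) (j : Fin N) : ptOf N v j = (numVec N v j : ℝ) / v.2 := rfl

/-- The integer numerators `Pᵢ` of a candidate tuple, as `Fin`-vectors. [folklore] -/
def Pof (N : ℕ) (cand : List LVert) : Fin (N + 1) → Fin N → ℤ := fun i j => (numer cand i).getD j 0

/-- The real points of a candidate tuple. [folklore] -/
def ptsOf (N : ℕ) (cand : List LVert) : Fin (N + 1) → Fin N → ℝ := fun i => ptOf N (vertAt cand i)

/-- `getD` through a map fixing the default. [folklore] -/
theorem getD_map_of_apply_default {α β : Type} (f : α → β) (l : List α) (n : ℕ) (d : α) :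
    (l.map f).getD n (f d) = f (l.getD n d) := by
  induction l generalizing n with
  | nil => simp
  | cons a l ih =>
    cases n with
    | zero => simp
    | succ n => simp only [List.map_cons, List.getD_cons_succ]; exact ih n

/-- Entries of `numer`: `(Pᵢ)ⱼ = (D / dᵢ) (pᵢ)ⱼ`. [folklore] -/
theorem numer_getD (cand : List LVert) (i j : ℕ) :
    (numer cand i).getD j 0 = ((denomProd cand / (vertAt cand i).2 : ℕ) : ℤ) * (vertAt cand i).1.getD j 0 := by
  rw [numer, ← getD_map_of_apply_default (fun z => ((denomProd cand / (vertAt cand i).2 : ℕ) : ℤ) * z)]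
  simp

/-- The common denominator is positive when all denominators are. [folklore] -/
theorem denomProd_pos {cand : List LVert} (h : ∀ v ∈ cand, 0 < v.2) : 0 < denomProd cand := by
  unfold denomProd
  induction cand with
  | nil => simp
  | cons v l ih =>
    rw [List.map_cons, List.prod_cons]
    exact Nat.mul_pos (h v List.mem_cons_self) (ih fun w hw => h w (List.mem_cons_of_mem _ hw))

/-- Each denominator divides the common denominator. [folklore] -/
theorem dvd_denomProd {cand : List LVert} {v : LVert} (hv : v ∈ cand) : v.2 ∣ denomProd cand :=
  List.dvd_prod (List.mem_map.2 ⟨v, hv, rfl⟩)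

/-- `vertAt` is an element for indices in range. [folklore] -/
theorem vertAt_mem {cand : List LVert} {i : ℕ} (hi : i < cand.length) : vertAt cand i ∈ cand := by
  rw [vertAt, List.getD_eq_getElem _ _ hi]; exact List.getElem_mem hi

/-- **`Pᵢ / D = pᵢ / dᵢ`**: the common-denominator numerators give the same real points.
[folklore] -/
theorem pts_Pof {cand : List LVert} (hlen : cand.length = N + 1) (hpos : ∀ v ∈ cand, 0 < v.2) :
    pts (Pof N cand) (denomProd cand) = ptsOf N cand := by
  funext i j
  have hi : (i : ℕ) < cand.length := by rw [hlen]; exact i.isLt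
  have hmem := vertAt_mem hi
  have hd := hpos _ hmem
  have hD := denomProd_pos hpos
  have hdvd := dvd_denomProd hmem
  rw [pts, Pof, numer_getD, ptsOf, ptOf_apply, numVec]
  obtain ⟨c, hc⟩ := hdvd
  have hc0 : 0 < c := Nat.pos_of_ne_zero fun h0 => by rw [h0, Nat.mul_zero] at hc; omega
  rw [hc, Nat.mul_div_cancel_left _ hd]
  have hd' : (0 : ℝ) < (vertAt cand i).2 := by exact_mod_cast hd
  have hc' : (0 : ℝ) < c := by exact_mod_cast hc0
  push_cast
  field_simp

/-- **`edgeRows` is the row list of the integer edge matrix.** [folklore] -/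
theorem edgeRows_eq (cand : List LVert) : edgeRows N cand = rowsOf (edgeInt (Pof N cand)) := by
  refine List.ext_getElem (by simp [edgeRows, rowsOf]) fun i h₁ h₂ => ?_
  simp only [edgeRows, List.getElem_map, List.getElem_range, rowsOf, List.getElem_ofFn]
  refine List.ext_getElem (by simp) fun j hj₁ hj₂ => ?_
  simp only [List.getElem_map, List.getElem_range, List.getElem_ofFn, edgeInt, Matrix.of_apply, Pof, Fin.val_succ,
    Fin.val_zero]

/-- Hence `detZ (edgeRows) = det W̃`. [cite: Berkowitz1984, §2] -/
theorem detZ_edgeRows (cand : List LVert) : detZ (edgeRows N cand) = (edgeInt (Pof N cand)).det := by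
  rw [edgeRows_eq]; exact detZ_rows _

/-- **`gRows` is the row list of `invMatrix W̃`.** [cite: Cohen1993, §2.6.3] -/
theorem gRows_eq (cand : List LVert) : gRows N cand = rowsOf (invMatrix (edgeInt (Pof N cand))) := by
  rw [gRows, edgeRows_eq]
  refine List.ext_getElem (by simp [rowsOf]) fun t h₁ h₂ => ?_
  simp only [List.getElem_map, List.getElem_range, rowsOf, List.getElem_ofFn]
  refine List.ext_getElem (by simp) fun k hk₁ hk₂ => ?_
  simp only [List.getElem_map, List.getElem_ofFn, invMatrix_apply]
  rw [getElem_invCols]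
  rfl

/-- `delta2 = det(W̃)²` for a nonsingular edge matrix. [cite: Cohen1993, §2.6.3] -/
theorem delta2_eq {cand : List LVert} (hdet : (edgeInt (Pof N cand)).det ≠ 0) :
    delta2 N cand = (edgeInt (Pof N cand)).det ^ 2 := by
  rw [delta2, edgeRows_eq, invDen_eq_det_sq hdet]

/-- **`baryNum v` lists the integer vector `(D p - d P₀) · invMatrix W̃`.** [folklore] -/
theorem baryNum_eq (cand : List LVert) (v : LVert) :
    baryNum N cand v = List.ofFn fun k : Fin N =>
      (((denomProd cand : ℤ) • numVec N v - (v.2 : ℤ) • Pof N cand 0) ᵥ* invMatrix (edgeInt (Pof N cand))) k := by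
  rw [baryNum, edgeRows_eq]
  refine List.ext_getElem (by simp) fun k hk₁ hk₂ => ?_
  simp only [List.getElem_map, List.getElem_ofFn]
  rw [getElem_invCols]
  have hw : ((List.range N).map fun j => (denomProd cand : ℤ) * v.1.getD j 0 - (v.2 : ℤ) * (numer cand 0).getD j 0) =
      List.ofFn fun j : Fin N => ((denomProd cand : ℤ) • numVec N v - (v.2 : ℤ) • Pof N cand 0) j := by
    refine List.ext_getElem (by simp) fun j hj₁ hj₂ => ?_
    simp [numVec, Pof]
  rw [hw, dotZ_eq_sum _ _ (D := N) (by simp) (by simp)]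
  simp only [vecMul, dotProduct, invMatrix_apply]
  refine Finset.sum_congr rfl fun t _ => ?_
  rw [List.getD_eq_getElem _ _ (by simp), List.getElem_ofFn]

/-! ### The barycentric test -/

/-- **The exact test decides the barycentric bounds**: for a candidate of `N + 1` vertices with positive
denominators and nonsingular edge matrix, and a vertex `v = p/d` (`d > 0`), `baryTest` holds iff all
barycentric coordinates of `p/d` with respect to the real tuple lie in `[-1, 1]`. [cite: LenstraHW1983, §2] -/
theorem baryTest_iff {cand : List LVert} (hlen : cand.length = N + 1) (hpos : ∀ v ∈ cand, 0 < v.2)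
    (hdet : (edgeInt (Pof N cand)).det ≠ 0) {v : LVert} (hv : 0 < v.2) :
    baryTest N cand v = true ↔ ∀ i, |bary (ptsOf N cand) (ptOf N v) i| ≤ 1 := by
  set P := Pof N cand with hP
  set D := denomProd cand with hDd
  set W := edgeInt P with hW
  set G := invMatrix W with hG
  set Δ₂ : ℤ := W.det ^ 2 with hΔ
  have hD : 0 < D := denomProd_pos hpos
  have hGeq : W * G = Δ₂ • (1 : Matrix (Fin N) (Fin N) ℤ) := mul_invMatrix hdet
  have hΔpos : 0 < Δ₂ := by positivity
  have hpts : ptsOf N cand = pts P D := (pts_Pof hlen hpos).symm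
  have hp : (homMat (pts P D)).det ≠ 0 := det_homMat_pts_ne_zero hD hdet
  -- the integer vector `q` and its relation to `τ`
  set q : Fin N → ℤ := ((D : ℤ) • numVec N v - (v.2 : ℤ) • P 0) ᵥ* G with hq
  have hτ : ∀ k, (q k : ℝ) = ((Δ₂ : ℝ) * v.2) * tauV (pts P D) (ptOf N v) k := by
    intro k
    have h := congrFun (smul_tauV_eq_vecMul hD hGeq hdet (ptOf N v)) k
    simp only [Pi.smul_apply, smul_eq_mul] at h
    have hd : (v.2 : ℝ) ≠ 0 := by exact_mod_cast hv.ne'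
    have hD' : (D : ℝ) ≠ 0 := by exact_mod_cast hD.ne'
    -- `D (x - p₀) = (D p - d P₀) / d`
    have hvec : (D : ℝ) • (ptOf N v - pts P D 0) = (v.2 : ℝ)⁻¹ • fun j => (((D : ℤ) • numVec N v - (v.2 : ℤ) • P 0) j : ℝ) := by
      funext j
      simp only [Pi.smul_apply, Pi.sub_apply, smul_eq_mul, ptOf_apply, pts, Int.cast_sub, Int.cast_mul, Int.cast_natCast]
      field_simp
    rw [hvec, smul_vecMul] at h
    have h' : (v.2 : ℝ) * ((Δ₂ : ℝ) * tauV (pts P D) (ptOf N v) k) =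
        ((fun j => (((D : ℤ) • numVec N v - (v.2 : ℤ) • P 0) j : ℝ)) ᵥ* G.map (Int.cast : ℤ → ℝ)) k := by
      rw [h, Pi.smul_apply, smul_eq_mul, ← mul_assoc, mul_inv_cancel₀ hd, one_mul]
    rw [show ((Δ₂ : ℝ) * v.2) * tauV (pts P D) (ptOf N v) k = (v.2 : ℝ) * ((Δ₂ : ℝ) * tauV (pts P D) (ptOf N v) k) by ring, h',
      hq]
    simp [vecMul, dotProduct, Matrix.map_apply]
  have hm : (0 : ℝ) < (Δ₂ : ℝ) * v.2 := by positivity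
  -- unfold the test
  have hbN : baryNum N cand v = List.ofFn q := by rw [baryNum_eq]
  have hd2 : delta2 N cand = Δ₂ := delta2_eq hdet
  rw [baryTest, hbN, hd2, Bool.and_eq_true, List.all_eq_true, decide_eq_true_eq, List.sum_ofFn]
  simp only [List.forall_mem_ofFn_iff, decide_eq_true_eq]
  -- coordinates `1 … N`
  have hsucc : ∀ k : Fin N, |q k| ≤ Δ₂ * v.2 ↔ |bary (pts P D) (ptOf N v) k.succ| ≤ 1 := by
    intro k
    rw [show bary (pts P D) (ptOf N v) k.succ = tauV (pts P D) (ptOf N v) k from rfl]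
    rw [← Int.cast_le (R := ℝ), Int.cast_abs, hτ k, abs_mul, abs_of_pos hm]
    push_cast
    constructor
    · intro h; nlinarith [abs_nonneg (tauV (pts P D) (ptOf N v) k)]
    · intro h; nlinarith [abs_nonneg (tauV (pts P D) (ptOf N v) k)]
  -- coordinate `0`
  have hzero : |Δ₂ * v.2 - ∑ k, q k| ≤ Δ₂ * v.2 ↔ |bary (pts P D) (ptOf N v) 0| ≤ 1 := by
    have h0 : bary (pts P D) (ptOf N v) 0 = 1 - ∑ k, tauV (pts P D) (ptOf N v) k := by
      have := sum_bary hp (ptOf N v)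
      rw [Fin.sum_univ_succ] at this
      simp only [tauV]; linarith
    have hsum : ((Δ₂ * v.2 - ∑ k, q k : ℤ) : ℝ) = ((Δ₂ : ℝ) * v.2) * bary (pts P D) (ptOf N v) 0 := by
      rw [h0]; push_cast; simp only [hτ, ← Finset.mul_sum]; ring
    rw [← Int.cast_le (R := ℝ), Int.cast_abs, hsum, abs_mul, abs_of_pos hm]
    push_cast
    constructor
    · intro h; nlinarith [abs_nonneg (bary (pts P D) (ptOf N v) 0)]
    · intro h; nlinarith [abs_nonneg (bary (pts P D) (ptOf N v) 0)]
  rw [hpts]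
  constructor
  · rintro ⟨h1, h2⟩ i
    refine Fin.cases ?_ (fun k => ?_) i
    · exact hzero.1 h2
    · exact (hsucc k).1 (h1 k)
  · intro h
    exact ⟨fun k => (hsucc k).2 (h k.succ), hzero.2 (h 0)⟩

/-- **`goodTuple` decides: nonsingular edge matrix and all of `V` inside the doubled simplex.**
[cite: LenstraHW1983, §2] -/
theorem goodTuple_iff {V : List LVert} (hV : ∀ v ∈ V, 0 < v.2) {cand : List LVert} (hcand : cand ∈ tuplesL (N + 1) V) :
    goodTuple N V cand = true ↔
      (edgeInt (Pof N cand)).det ≠ 0 ∧ ∀ v ∈ V, ∀ i, |bary (ptsOf N cand) (ptOf N v) i| ≤ 1 := by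
  obtain ⟨hlen, hmem⟩ := mem_tuplesL_iff.1 hcand
  have hpos : ∀ v ∈ cand, 0 < v.2 := fun v hv => hV v (hmem v hv)
  rw [goodTuple, Bool.and_eq_true, decide_eq_true_eq, detZ_edgeRows, List.all_eq_true]
  constructor
  · rintro ⟨hdet, hall⟩
    exact ⟨hdet, fun v hv => (baryTest_iff hlen hpos hdet (hV v hv)).1 (hall v hv)⟩
  · rintro ⟨hdet, hall⟩
    exact ⟨hdet, fun v hv => (baryTest_iff hlen hpos hdet (hV v hv)).2 (hall v hv)⟩

/-! ### A good tuple exists and is found -/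

/-- The real tuple of `List.ofFn`. [folklore] -/
theorem ptsOf_ofFn (w : Fin (N + 1) → LVert) : ptsOf N (List.ofFn w) = fun i => ptOf N (w i) := by
  funext i
  simp only [ptsOf, vertAt]
  rw [List.getD_eq_getElem _ _ (by rw [List.length_ofFn]; exact i.isLt), List.getElem_ofFn]

/-- **A good tuple exists when the polytope contains a box** (file II: a maximal-volume tuple of the
finite vertex set). [cite: LenstraHW1983, §2 (maximal simplex)] -/
theorem exists_goodTuple {V : List LVert} (hV : ∀ v ∈ V, 0 < v.2) {x₀ : Fin N → ℝ} {ρ : ℝ} (hρ : 0 < ρ)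
    (hbox : ∀ y : Fin N → ℝ, (∀ j, |y j - x₀ j| ≤ ρ) → y ∈ convexHull ℝ (((V.map (ptOf N)).toFinset : Finset _) : Set (Fin N → ℝ))) :
    ∃ cand ∈ tuplesL (N + 1) V, goodTuple N V cand = true := by
  classical
  obtain ⟨p, hpV, hpdet, hbary⟩ := exists_maxVolume_tuple (V := (V.map (ptOf N)).toFinset) hρ hbox
  -- the vertices behind the points
  have hw : ∀ i, ∃ v ∈ V, ptOf N v = p i := fun i => by
    have := hpV i
    rw [List.mem_toFinset, List.mem_map] at this
    exact this
  choose w hw using hw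
  refine ⟨List.ofFn w, ofFn_mem_tuplesL w fun i => (hw i).1, ?_⟩
  have hcand : List.ofFn w ∈ tuplesL (N + 1) V := ofFn_mem_tuplesL w fun i => (hw i).1
  rw [goodTuple_iff hV hcand]
  have hpts : ptsOf N (List.ofFn w) = p := by
    rw [ptsOf_ofFn]; funext i; exact (hw i).2
  have hlen : (List.ofFn w).length = N + 1 := List.length_ofFn
  have hpos : ∀ v ∈ List.ofFn w, 0 < v.2 := fun v hv => hV v ((mem_tuplesL_iff.1 hcand).2 v hv)
  refine ⟨?_, fun v hv i => ?_⟩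
  · intro h0
    apply hpdet
    rw [← hpts, ← pts_Pof hlen hpos, det_homMat_pts, h0, Int.cast_zero, zero_div]
  · rw [hpts]
    exact hbary _ (List.mem_toFinset.2 (List.mem_map.2 ⟨v, hv, rfl⟩)) i

/-- Members of `goodTuples` are good candidate tuples. [folklore] -/
theorem mem_goodTuples_iff {V : List LVert} {cand : List LVert} :
    cand ∈ goodTuples N V ↔ cand ∈ tuplesL (N + 1) V ∧ goodTuple N V cand = true := by
  rw [goodTuples, List.mem_filter]

/-- If `goodTuples` is non-empty, its head is a member. [folklore] -/
theorem headD_mem_of_isEmpty_eq_false {α : Type} {l : List α} (d : α) (h : l.isEmpty = false) : l.headD d ∈ l := by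
  cases l with
  | nil => simp at h
  | cons a l => simp

/-- **When a good tuple exists, the search finds one**: `goodTuples` is non-empty and its head is a good
tuple of vertices. [cite: LenstraHW1983, §2] -/
theorem head_goodTuples {V : List LVert} (h : ∃ cand ∈ tuplesL (N + 1) V, goodTuple N V cand = true) :
    (goodTuples N V).isEmpty = false ∧
      (goodTuples N V).headD [] ∈ tuplesL (N + 1) V ∧ goodTuple N V ((goodTuples N V).headD []) = true := by
  obtain ⟨cand, hc, hg⟩ := h
  have hmem : cand ∈ goodTuples N V := mem_goodTuples_iff.2 ⟨hc, hg⟩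
  have hne : (goodTuples N V).isEmpty = false := by
    cases hl : goodTuples N V with
    | nil => rw [hl] at hmem; simp at hmem
    | cons a l => rfl
  exact ⟨hne, mem_goodTuples_iff.1 (headD_mem_of_isEmpty_eq_false [] hne)⟩

end FixedDimILP

end Literature.Computability.Complexity
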